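/-
Copyright: lit-balaban Phase-2 proof seat p30 (gen 6).  Statement-level skeleton of a published paper; no proof claims beyond what
the kernel checks below.
-/
import Literature.MathematicalPhysics.QuantumFieldTheory.BalabanImbrieJaffe1984to88.BIJ85Sigma320Torus
import Literature.MathematicalPhysics.QuantumFieldTheory.BalabanImbrieJaffe1984to88.BIJ85Eq317Proof

/-!
# `BalabanImbrieJaffe1984to88.BIJ85Eq317Torus` — T. Bałaban, J. Imbrie, A. Jaffe, *Renormalization of the Higgs model: minimizers,
propagators and the stability of mean field theory*, Commun. Math. Phys. **97** (1985) 299–329 [BalabanImbrieJaffe1985]: Sect. 3,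
**(3.15)–(3.18) AT THE TORUS MODEL INSTANCE** — seat p30 gen 1's abstract `BIJ85Eq317Proof` (Prop. A1 / Cor. A2 with `α = ∂`, the
constraint space `ℋ₀` as carrier, `C = (∂^*∂)^{−1}` on `ℋ₀` as the hypothesis `hC`, `Σ` as the hypothesis `h318`) INSTANTIATED on the tori:
`ℋ₀ = Wstep P 0` = δ(QA)δ_{Ax}(A), `α = ∂|ℋ₀`, `C = (α^*α)^{−1}` (p09's `formInv`; well defined: no zero modes of ∂ on `ℋ₀`, p11's `hD_V411` at
`k = 1`), and `Σ = L^{−d}Q^e(I − ∂C∂^*)Q^{e*} = L^{−d}σ₁` with σ₁ the torus σ of (4.2.1)–(4.2.2) at `k = 1` (`BIJ85Sigma320Torus.sigma_one_eq`) —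
every hypothesis of gen 1 discharged

statement-level skeleton of published theorems with citation tags; proofs where landed; nothing here is a claim about the Yang–Mills mass gap

PDF held: `paper:balaban1985-cmp97-bij-higgs-minimizers` (journal page = PDF page + 298).  Pages read as images: p. 307 [PDF 9]
(`HOME/lit-balaban-r15/pages/1985-cmp97-bij-higgs-minimizers-p009-x2.png`), p. 327 [PDF 29].

CITATION HEADER (lean-in-tree rule).  Part of the lit-balaban TYPED SKELETON (HOME `run/shared/lean/pub/lit-balaban/`), Phase-2
seat p30 (gen 6), unit `lit-balaban-p30`; WHAT IS REPRODUCED = rows **C1.Eq3.15-3.16** and **C1.Eq3.17-3.18** of `HOME/SKELETON.md` (reader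
file `HOME/lit-balaban-r15/ROWS-C1.md`) AT THE TORUS MODEL OF RECORD (kind «model-instance»).

THE PRINTED TEXT (p. 307 [PDF 9], verbatim): *"Let us translate the quadratic form (3.13) to its minimum. This can be done using the
Appendix, with α = ∂. The minimum of ½‖∂A + L^{−d/2}Q^{e*}F‖², subject to the constraints that A is axial gauge and QA = 0, is attained at
A_cl = −L^{−d/2}C∂^*Q^{e*}F, (3.15) where C = (∂^*∂)^{−1}, restricted to the subspace of A's satisfying the constraints. Furthermore, the
fluctuation field A′ = A + A_cl (3.16) has a Gaussian distribution with mean zero and covariance C. Furthermore, by Corollary A2, ½‖∂A + B‖²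
= ½⟨A′, C^{−1}A′⟩ + ½⟨B, (I − P)B⟩, (3.17) where P = ∂C∂^* is the orthogonal projection onto the range of ∂. Note that if we define Σ =
L^{−d}Q^e(I − P)Q^{e*}, then ⟨B, (I − P)B⟩ = ⟨F, ΣF⟩. (3.18)"*

THE TORUS DATA: `ℋ₀ = Wstep P 0` (δ(QA)δ_{Ax}(A) on the η-bond fields; the carrier of gen 1's `E`), `α = curlOp w c ∘ ℋ₀.subtype : ℋ₀ → PlaqSpace P`,
`α^* = LinearMap.adjoint α`, `C = formInv α` (= `(α^*α)^{−1}`, p09's `BIJ85AxialPropagator411.formInv`; the ambient (4.1.1)-type operator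
`axialPropagator (Wstep P 0) ∂ = ℋ₀.subtype ∘ C ∘ ℋ₀.subtype^*` is the `C` of `BIJ85Sigma320Torus`), `Q^{e*} = QesOp hd w 1`, `Q^e` its adjoint,
`B = lQ^{e*}F`, `l = L^{−d/2}`, `Σ = l²·sigmaTorus hd w c 1`.

WHAT IS PROVED: `noZeroModes_Wstep0` (∂ has no zero modes on `ℋ₀`: gen 3's `noZeroModes_DH` with `H_{0,Ax} = I`), `alpha_injective`, `hC_torus`
(`α^*αC = I` on `ℋ₀`), `curlC_eq` (`αCα^* = ∂·axialPropagator·∂^*`), `h318_torus` (`Σ = l²Q^e(I − αCα^*)Q^{e*}`); **`eq315_min_torus`** ((3.15) is the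
minimum on `ℋ₀`), **`res315_torus`** (∂A_cl + B = (I − P)B with `P = αCα^*` a self-adjoint projection), **`eq317_torus`** ((3.16)–(3.18):
`½‖∂(A + A_cl) + B‖² = ½‖∂A‖² + ½⟨F, ΣF⟩` for every `A ∈ ℋ₀`, `Σ = L^{−d}σ₁`).  Standing range `1 ≤ m + K`; `c ≠ 0`, `w > 0`, `2 ≤ d`.  D-0026:
theorems only, no `def`, no new named fact.  Unit `lit-balaban-p30` (literature-prover-lit-balaban-p30-g6-0), 2026-08-21.
-/

open scoped BigOperators RealInnerProductSpace

namespace Literature.MathematicalPhysics.QuantumFieldTheory.BalabanImbrieJaffe1984to88.BIJ85Eq317Torus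

open Literature.MathematicalPhysics.QuantumFieldTheory.Balaban1983to89
open LatticeFieldCalculus BIJ85AppAStatements BIJ85AxialPropagator411 BIJ85SigmaForm421 BIJ85UnitPropagator433 BIJ85Prop521Proof
  BIJ85Prop521Torus BIJ85Sigma421Torus BIJ85Eq611Torus BIJ85Prop522Torus BIJ85Eq531Inputs BIJ85SigmaTorusScaling BIJ85Eq625Torus
  BIJ85Sigma320Torus BIJ85Eq317Proof

noncomputable section

variable {P : Params}

/-! ## 1. `ℋ₀ = Wstep P 0` as carrier: no zero modes of `∂`, `C = (∂^*∂)^{−1}` -/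

/-- **no zero modes of `∂` on `ℋ₀ = δ(QA)δ_{Ax}(A)`** (the `k = 1` instance of the p. 309 claim): gen 3's `noZeroModes_DH` for the step
`0 → 1` (no zero modes on `V411 P 1` = p11's `hD_V411`, the constraint tower `factor_V411`) with `H_{0,Ax} = I` (`BIJ85Sigma320Torus.HaxE_zero`);
`1 ≤ m + K`, `c ≠ 0`, `w > 0`. [cite: BalabanImbrieJaffe1985, p.309 (text)] -/
theorem noZeroModes_Wstep0 (h1 : 1 ≤ P.m + P.K) {c : ℝ} (hc : c ≠ 0) {w : ℝ} (hw : 0 < w) :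
    ∀ v : Wstep P 0, curlOp (P := P) w c (v : CoarseSpace P 0) = 0 → v = 0 := by
  intro v hv
  have h := noZeroModes_DH (V := V411 P 1) (V' := V411 P 0) (W := Wstep P 0) (D := curlOp (P := P) w c) (Qc := QcE P 0)
    (Qs := QsE P 0) (hD_V411 h1 hc hw) (QcE_QsE (Nat.zero_le _)) (fun v => QcE_eq_zero_of_mem v.2) (factor_V411 (Nat.zero_le _)) v
  apply h
  rw [LinearMap.comp_apply, show HaxOp (V411 P 0) (curlOp (P := P) w c) (QsE P 0) = HaxE P w c 0 from rfl, HaxE_zero]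
  exact hv

/-- `α = ∂|ℋ₀` is injective. [cite: BalabanImbrieJaffe1985, p.309 (text)] -/
theorem alpha_injective (h1 : 1 ≤ P.m + P.K) {c : ℝ} (hc : c ≠ 0) {w : ℝ} (hw : 0 < w) :
    Function.Injective (curlOp (P := P) w c ∘ₗ (Wstep P 0).subtype) := by
  intro v v' h
  have h0 : (curlOp (P := P) w c ∘ₗ (Wstep P 0).subtype) (v - v') = 0 := by rw [map_sub, h, sub_self]
  exact sub_eq_zero.1 (noZeroModes_Wstep0 h1 hc hw _ h0)

/-- **`C = (∂^*∂)^{−1}` on `ℋ₀`** (p. 307: *"C = (∂^*∂)^{−1}, restricted to the subspace of A's satisfying the constraints"*): p09's `formInv α`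
satisfies `α^*(α(Cx)) = x` — gen 1's hypothesis `hC`; `1 ≤ m + K`, `c ≠ 0`, `w > 0`. [cite: BalabanImbrieJaffe1985, (3.15) p.307] -/
theorem hC_torus (h1 : 1 ≤ P.m + P.K) {c : ℝ} (hc : c ≠ 0) {w : ℝ} (hw : 0 < w) (x : Wstep P 0) :
    LinearMap.adjoint (curlOp (P := P) w c ∘ₗ (Wstep P 0).subtype)
        ((curlOp (P := P) w c ∘ₗ (Wstep P 0).subtype) (formInv (curlOp (P := P) w c ∘ₗ (Wstep P 0).subtype) x)) = x := by
  have h := formOp_formInv (alpha_injective h1 hc hw) x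
  rw [formOp, LinearMap.comp_apply] at h
  exact h

/-- `αCα^* = ∂·G·∂^*` with `G = axialPropagator (Wstep P 0) ∂ = ℋ₀.subtype ∘ C ∘ ℋ₀.subtype^*` the ambient operator (= `G_{1,Ax} = C`,
`BIJ85Sigma320Torus.axialPropagator_one`): the projection `P = ∂C∂^*` of (3.17) read on the η-plaquette fields. [cite: BalabanImbrieJaffe1985, (3.17) p.307] -/
theorem curlC_eq (w c : ℝ) :
    (curlOp (P := P) w c ∘ₗ (Wstep P 0).subtype) ∘ₗ formInv (curlOp (P := P) w c ∘ₗ (Wstep P 0).subtype)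
        ∘ₗ LinearMap.adjoint (curlOp (P := P) w c ∘ₗ (Wstep P 0).subtype) =
      curlOp (P := P) w c ∘ₗ axialPropagator (Wstep P 0) (curlOp (P := P) w c) ∘ₗ LinearMap.adjoint (curlOp (P := P) w c) := by
  rw [LinearMap.adjoint_comp, axialPropagator]
  rfl

/-- **`Σ = L^{−d}Q^e(I − ∂C∂^*)Q^{e*}`** ((3.18)) for the torus σ₁: `l²·sigmaTorus hd w c 1 = l²·Q^e(I − αCα^*)Q^{e*}` — gen 1's hypothesis `h318`
(`BIJ85Sigma320Torus.sigma_one_eq` + `curlC_eq`); `1 ≤ m + K`, `c ≠ 0`, `w > 0`. [cite: BalabanImbrieJaffe1985, (3.18) p.307] -/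
theorem h318_torus (hd : 2 ≤ P.d) (h1 : 1 ≤ P.m + P.K) {c : ℝ} (hc : c ≠ 0) {w : ℝ} (hw : 0 < w) (l : ℝ) :
    l ^ 2 • sigmaTorus (P := P) hd w c 1 =
      l ^ 2 • (LinearMap.adjoint (QesOp (P := P) hd w 1)
        ∘ₗ (LinearMap.id - (curlOp (P := P) w c ∘ₗ (Wstep P 0).subtype)
              ∘ₗ formInv (curlOp (P := P) w c ∘ₗ (Wstep P 0).subtype)
              ∘ₗ LinearMap.adjoint (curlOp (P := P) w c ∘ₗ (Wstep P 0).subtype))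
        ∘ₗ QesOp (P := P) hd w 1) := by
  rw [curlC_eq, sigma_one_eq hd h1 hc hw]

/-! ## 2. (3.15)–(3.18) on the tori -/

/-- **(3.15) ON THE TORI — the minimum** p. 307 [PDF 9]: *"The minimum of ½‖∂A + L^{−d/2}Q^{e*}F‖², subject to the constraints that A is
axial gauge and QA = 0, is attained at A_cl = −L^{−d/2}C∂^*Q^{e*}F, (3.15)"* — for every `A ∈ ℋ₀ = Wstep P 0`: `h(A_cl) ≤ h(A)`, `h(A) = ½‖∂A +
lQ^{e*}F‖²` (`BIJ85AppAStatements.hForm`), `A_cl = −l·C(α^*(Q^{e*}F))`, `C = formInv α`; gen 1's `eq315_min` (Prop. A1 (A2)) with `hC` discharged;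
`1 ≤ m + K`, `c ≠ 0`, `w > 0`. [cite: BalabanImbrieJaffe1985, (3.15) p.307] -/
theorem eq315_min_torus (hd : 2 ≤ P.d) (h1 : 1 ≤ P.m + P.K) {c : ℝ} (hc : c ≠ 0) {w : ℝ} (hw : 0 < w) (l : ℝ)
    (F : UnitPlaqSpace P 1) (A : Wstep P 0) :
    hForm (curlOp (P := P) w c ∘ₗ (Wstep P 0).subtype) (l • QesOp (P := P) hd w 1 F)
        (-(l • formInv (curlOp (P := P) w c ∘ₗ (Wstep P 0).subtype)
          (LinearMap.adjoint (curlOp (P := P) w c ∘ₗ (Wstep P 0).subtype) (QesOp (P := P) hd w 1 F)))) ≤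
      hForm (curlOp (P := P) w c ∘ₗ (Wstep P 0).subtype) (l • QesOp (P := P) hd w 1 F) A :=
  eq315_min _ _ (fun x y => (LinearMap.adjoint_inner_right _ x y).symm) _ (hC_torus h1 hc hw) _ l F A

/-- **(3.15)/(3.17) ON THE TORI — at the minimum** `∂A_cl + B = (I − P)B`, `P = ∂C∂^*` a SELF-ADJOINT PROJECTION (p. 307: *"P = ∂C∂^* is the
orthogonal projection onto the range of ∂"*); gen 1's `res315` with `hC` discharged. [cite: BalabanImbrieJaffe1985, (3.17) p.307] -/
theorem res315_torus (hd : 2 ≤ P.d) (h1 : 1 ≤ P.m + P.K) {c : ℝ} (hc : c ≠ 0) {w : ℝ} (hw : 0 < w) (l : ℝ)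
    (F : UnitPlaqSpace P 1) :
    let α := curlOp (P := P) w c ∘ₗ (Wstep P 0).subtype
    let Qop : PlaqSpace P →ₗ[ℝ] PlaqSpace P := LinearMap.id - α ∘ₗ formInv α ∘ₗ LinearMap.adjoint α
    α (-(l • formInv α (LinearMap.adjoint α (QesOp (P := P) hd w 1 F)))) + l • QesOp (P := P) hd w 1 F =
        Qop (l • QesOp (P := P) hd w 1 F) ∧
      (∀ x y : PlaqSpace P, ⟪Qop x, y⟫ = ⟪x, Qop y⟫) ∧ (∀ x : PlaqSpace P, Qop (Qop x) = Qop x) :=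
  res315 _ _ (fun x y => (LinearMap.adjoint_inner_right _ x y).symm) _ (hC_torus h1 hc hw) _ l F _ rfl

/-- **(3.16)–(3.18) ON THE TORI** p. 307 [PDF 9], verbatim: *"the fluctuation field A′ = A + A_cl (3.16) … by Corollary A2, ½‖∂A + B‖² =
½⟨A′, C^{−1}A′⟩ + ½⟨B, (I − P)B⟩, (3.17) … if we define Σ = L^{−d}Q^e(I − P)Q^{e*}, then ⟨B, (I − P)B⟩ = ⟨F, ΣF⟩. (3.18)"* — for every `A ∈ ℋ₀
= Wstep P 0` and every L-lattice plaquette field `F`: `½‖∂(A + A_cl) + lQ^{e*}F‖² = ½‖∂A‖² + ½⟨F, ΣF⟩` with `A_cl = −l·C∂^*Q^{e*}F` ((3.15)),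
`C = (∂^*∂)^{−1}` on `ℋ₀` and **`Σ = l²σ₁ = L^{−d}·sigmaTorus hd w c 1`** (the torus σ of (4.2.1) at `k = 1`; `l = L^{−d/2}`); gen 1's `eq317`
(Corollary A2 + Proposition A1) with BOTH hypotheses `hC`, `h318` discharged (`hC_torus`, `h318_torus`); `1 ≤ m + K`, `c ≠ 0`, `w > 0`, `2 ≤ d`.
[cite: BalabanImbrieJaffe1985, (3.17) p.307] -/
theorem eq317_torus (hd : 2 ≤ P.d) (h1 : 1 ≤ P.m + P.K) {c : ℝ} (hc : c ≠ 0) {w : ℝ} (hw : 0 < w) (l : ℝ)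
    (F : UnitPlaqSpace P 1) (A : Wstep P 0) :
    hForm (curlOp (P := P) w c ∘ₗ (Wstep P 0).subtype) (l • QesOp (P := P) hd w 1 F)
        (A + -(l • formInv (curlOp (P := P) w c ∘ₗ (Wstep P 0).subtype)
          (LinearMap.adjoint (curlOp (P := P) w c ∘ₗ (Wstep P 0).subtype) (QesOp (P := P) hd w 1 F)))) =
      (1 / 2) * ‖(curlOp (P := P) w c ∘ₗ (Wstep P 0).subtype) A‖ ^ 2
        + (1 / 2) * ⟪F, (l ^ 2 • sigmaTorus (P := P) hd w c 1) F⟫ :=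
  eq317 _ _ (fun x y => (LinearMap.adjoint_inner_right _ x y).symm) _ (hC_torus h1 hc hw) _ _
    (fun f g => (LinearMap.adjoint_inner_left _ g f)) l _ (h318_torus hd h1 hc hw l) F A

/-- (3.17)–(3.19) combined with the printed `l = L^{−d/2}`: `½‖∂(A + A_cl) + L^{−d/2}Q^{e*}F‖² = ½‖∂A‖² + ½⟨F, σ₁^{(L^{−d}w)}F⟩` — the right
member read after the scaling to the unit lattice ((3.19), `BIJ85Sigma320Torus.eq319_torus`). [cite: BalabanImbrieJaffe1985, (3.19) p.308] -/
theorem eq317_319_torus (hd : 2 ≤ P.d) (h1 : 1 ≤ P.m + P.K) {c c' : ℝ} (hc : c ≠ 0) (hc' : c' ≠ 0) {w : ℝ} (hw : 0 < w)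
    (F : UnitPlaqSpace P 1) (A : Wstep P 0) :
    let l : ℝ := (Real.sqrt (P.L : ℝ))⁻¹ ^ P.d
    hForm (curlOp (P := P) w c ∘ₗ (Wstep P 0).subtype) (l • QesOp (P := P) hd w 1 F)
        (A + -(l • formInv (curlOp (P := P) w c ∘ₗ (Wstep P 0).subtype)
          (LinearMap.adjoint (curlOp (P := P) w c ∘ₗ (Wstep P 0).subtype) (QesOp (P := P) hd w 1 F)))) =
      (1 / 2) * ‖(curlOp (P := P) w c ∘ₗ (Wstep P 0).subtype) A‖ ^ 2
        + (1 / 2) * ⟪F, sigmaTorus (P := P) hd (((P.L : ℝ) ^ P.d)⁻¹ * w) c' 1 F⟫ := by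
  intro l
  have hL : (0 : ℝ) < (P.L : ℝ) := by have := P.hL.2; positivity
  have hl0 : l ≠ 0 := pow_ne_zero _ (inv_ne_zero (Real.sqrt_pos.2 hL).ne')
  have hl : l ^ 2 = ((P.L : ℝ) ^ P.d)⁻¹ := by
    show ((Real.sqrt (P.L : ℝ))⁻¹ ^ P.d) ^ 2 = _
    rw [← pow_mul, mul_comm, pow_mul, inv_pow, Real.sq_sqrt hL.le, inv_pow]
  rw [eq317_torus hd h1 hc hw l F A, eq319_torus hd h1 hc hc' hw hl0 F, hl]

end

end Literature.MathematicalPhysics.QuantumFieldTheory.BalabanImbrieJaffe1984to88.BIJ85Eq317Torus
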